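import Literature.NumberTheory.GaloisRepresentations.PresentationLayerTransport
import Literature.NumberTheory.GaloisRepresentations.GaloisCohomologyInflationColimit
import Literature.NumberTheory.GaloisRepresentations.GaloisCohomologyExtOneLayerDescent
import Literature.NumberTheory.GaloisRepresentations.GalLayerSystemSESLayers
import Literature.NumberTheory.GaloisRepresentations.HomDualShaTwoConnecting
import Literature.NumberTheory.GaloisRepresentations.HomDualReadoutLayerCocycle
import Literature.NumberTheory.GaloisRepresentations.IdeleClassH2Sequence
import HarnessLib

/-!
# The Ш²-cochain bridge, step S3 (class side): the two IDENTIFICATIONS of the continuous class `[j_C ∘ Z] ∈ H²_cont(Γ_K, C̄)`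
# with inflated layer classes — (I2) presentation side `h_* δ₁[γ] = inf_E (toAbsLayer ((h^{U_E})_* δ c_E))`, and
# (I1) idèle side `(j_C)_* inf_E (toAbsLayer w) = inf_E (toAbsLayer ((j_C^{U_E})_* w))`, `iso_C ((j_C^{U_E})_* w) = ε_E (iso_J w)`
# (Serre CG I §2.2 Prop. 8; Tate, C–F VII §11.1–11.2; Milne ADT I Thm. 4.10 (a), proof)

Route `SemiOrdinaryEisensteinDescent` (BSD, rung W-ALL row 2·3@3), Kolyvagin column, Cassels–Tate lane: print item
`CasselsTateLevelInputsFact` (stmt-BirchSwinnertonDyer-20191).  After w4 g2's `…ShaTwoCochainBridgeAssembly` (p643550,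
`ShaTwoCochainTheta.hbridge_of_globalInvariantSum`) the ONE remaining displayed statement is road B's global invariant sum
`hS3` «`Σ_v inv_{K_v}[π_v Z|_{Γ_v}] = classBarInv K (Φ⁻¹[γ] ∘ ∂h)`» for idèle `2`-cocycles `Z` with `j_C ∘ Z = h ∘ c`, `[c] = δ₁[γ]`
(memo `Cruxes/WildKolyvaginUpperAtThree/S3-IDELE-DESCENT-w2g11.md` §3).  Its proof compares two finite-layer numbers
`classInvAll K E₁ (iso_{E₁} w₁)` (road B, `IdeleClassBar.classBarInv_inflG_comp_boundary_eq_classInvAll`) and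
`classInvAll K E₂ (iso_{E₂} w₂) = inv_{E₂}[b] = Σ_v` (S3 idèle side, `…ShaTwoCochainIdeleInvariantSum`) through the
continuous class `[j_C ∘ Z]`; THIS FILE supplies the two identifications of that class with the inflations of `w₁` and `w₂`
((I2) and (I1) of the memo), for an ARBITRARY finite discrete module `ρ` (no elliptic curve, no pairing):

* §1 **`map_lmap_infTwo_toAbsLayer`** — NATURALITY of `inf_E ∘ toAbsLayer_E : H²(Γ_K ⧸ U_E, X^{U_E}) → H²_cont(Γ_K, X)` in the
  coefficient object `X : C_Γ`: for `u : X ⟶ Y`, `H²(u) (inf_E (toAbsLayer_E w)) = inf_E (toAbsLayer_E (H²(u^{U_E}) w))`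
  (both are the class of the continuous cocycle `(σ, τ) ↦ u (b([σ], [τ]))`; Serre I §2.2 Prop. 8, functoriality);
* §2 `map_two_twoCocycleClass_eq_of_apply` — `H²(φ)[Z] = [Z']` when `Z' = φ ∘ Z` pointwise;
* §3 (I1) **`map_ideleToClassI_infTwo_toAbsLayer`** (`(j_C)_* inf_E (toAbsLayer_E w) = inf_E (toAbsLayer_E ((j_C^{U_E})_* w))` for
  `w ∈ H²(Γ_K ⧸ U_E, J̄^{U_E})`) and **`layerCohomologyIso_hom_map_ideleToClass`** (`iso_C ((j_C^{U_E})_* w) = ε_E (iso_J w)`,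
  `ε_E = IdeleCohomology.ideleToClass K E : H²(Gal(E/K), J_E) → H²(Gal(E/K), C_E)`; door-c5
  `functor_map_ideleToClass_comp_layerCohomologyIso`), packaged as `ideleSide_identification`;
* §4 (I2) **`infOpen_eq_infOneLayer_toAbsLayerOf`** (door-c5's `inf_U` on the layer `U_E` is `infOneLayer ∘ toAbsLayerOf`),
  `extOneToGaloisCohomology_inflG_layer` (`Φ (Inf_E c) = infOneLayer (toAbsLayerOf c)`),
  **`map_lmap_δ₁_eq_infTwo_toAbsLayer`** (`Φ (Inf_E c) = y`, `E ⊇ K(M)` ⇒ `H²(u) (δ₁ y) = inf_E (toAbsLayer_E ((u^{U_E})_* δ_{S^{U_E}} c))`,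
  (N2) `LayerDelta.δ₁_infOneLayer_toAbsLayerOf` + §1), **`map_ideleToClassI_twoCocycleClass_eq_infTwo_toAbsLayer`** (the same read
  on an idèle cocycle `Z` with `j_C ∘ Z = h ∘ c`, `[c] = δ₁[γ]`), the E-side value `classBarInv_inflG_comp_boundary_presentation_hom`
  (road B for a general `h : N₁ → C̄`, not only `f ≫ g`) and the package **`presentationSide_identification`**: for every `γ`, `c`
  with `[c] = δ₁[γ]` there are a layer `E ⊇ K(M)` and `w₁ ∈ H²(Γ_K ⧸ U_E, C̄^{U_E})` with
  `classBarInv K (Φ⁻¹[γ] ∘ ∂h) = classInvAll K E (iso_E w₁)` and `(j_C)_*[Z] = inf_E (toAbsLayer_E w₁)` for EVERY idèle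
  `2`-cocycle `Z` with `j_C ∘ Z = h ∘ c`.

With w2 g11's (T-C) `classInvAll_eq_of_infTwo_toAbsLayer_eq` (`…ShaTwoCochainClassInvariant`) and α/β/γ triangle
(`…ShaTwoCochainLayerTriangle`), `IdeleCohomology.classInvAll_ideleToClass` and `…IdeleInvariantSum`, these give `hS3` (with its
archimedean hypothesis).  THEOREMS ONLY (no definition, no instance, no instance attribute, no named fact, no `sorry`); bookkeeping over
door-c4/c5/c6's dictionaries — no case of BSD, of Poitou–Tate or of Cassels–Tate is proved; BSD is not proved by any of this.
Width seat `bsd-wall-soed-p2-w5` g6; `--supports stmt-BirchSwinnertonDyer-20480`, helper.  Route-free (no `Theses` import).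

## References
* [SerreGaloisCohomology1997] J.-P. Serre, *Galois Cohomology* (1997), I §2.2 Proposition 8 and Corollary 1, I §2.4.
* [CasselsFrohlichANT1967] J. W. S. Cassels, A. Fröhlich (eds.), *Algebraic Number Theory* (1967), Ch. VII (J. Tate) §8, §11.1,
  §11.2 (bis).
* [MilneADT2006] J. S. Milne, *Arithmetic Duality Theorems*, 2nd ed. (2006), I §4, Thm. 4.10 (a) and its proof (p. 58), Lemma 4.13.
* [NeukirchSchmidtWingberg2008] J. Neukirch, A. Schmidt, K. Wingberg, *Cohomology of Number Fields* (2008), (1.5.1).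
-/

noncomputable section

set_option linter.dupNamespace false
set_option autoImplicit false

namespace Summit.BirchSwinnertonDyer.BirchSwinnertonDyer.Theorems.ShaTwoCochain

open CategoryTheory CategoryTheory.Abelian groupCohomology Field NumberField IsDedekindDomain
open Literature.NumberTheory.GaloisRepresentations Literature.NumberTheory.GaloisRepresentations.IdeleClassBar
open Literature.NumberTheory.GaloisRepresentations.DGMBridge Literature.NumberTheory.GaloisRepresentations.LayerDelta
open Literature.NumberTheory.GaloisRepresentations.FreePresentation Literature.NumberTheory.GaloisRepresentations.HomDual
open Literature.Algebra.Homology Literature.Algebra.Homology.DiscreteRep Literature.Algebra.Homology.ExtPresentation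
open scoped ContRepresentation

-- `LocallyCompactSpace Γ_K` (needed by `twoCocycleClass`) comes from the tree's instance
-- `absoluteGaloisGroup.instCompactSpace [CharZero ·]` (`K` a number field).

variable {K : Type} [Field K] [NumberField K]

/-! ## §1 Naturality of `inf_E ∘ toAbsLayer_E` in the coefficient object -/

/-- **Naturality of `inf_E ∘ toAbsLayer_E : H²(Γ_K ⧸ U_E, X^{U_E}) → H²_cont(Γ_K, X)` in `X : C_Γ`.**  For a morphism
`u : X ⟶ Y` of `C_Γ`, a layer `E` and `w ∈ H²(Γ_K ⧸ U_E, X^{U_E})`: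
`H²(u) (inf_E (toAbsLayer_E w)) = inf_E (toAbsLayer_E (H²(Γ_K ⧸ U_E, u^{U_E}) w))` — on a cocycle `b` of `w` both sides are the
class of the continuous `2`-cocycle `(σ, τ) ↦ u (b([σ], [τ]))` of `Γ_K` (`toAbsLayer_H2π`, `infTwo_H2π`, `map_twoCocycleClass`,
Mathlib `H2π_comp_map_apply`). [cite: SerreGaloisCohomology1997, I §2.2 Proposition 8, §2.4] -/
theorem map_lmap_infTwo_toAbsLayer (E : GalLayer K) [Normal K E.1] [FiniteDimensional K E.1]
    (X Y : DiscreteRepCat ℤ (absoluteGaloisGroup K)) (u : X ⟶ Y)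
    (w : groupCohomology ((invariantsQuotFunctor ℤ (E.openNormalSubgroup : Subgroup (absoluteGaloisGroup K))).obj X) 2) :
    galoisCohomology.map (lmap X Y u) 2 (infTwo K E.1 (toDGM X) (toAbsLayer E X 2 w)) =
      infTwo K E.1 (toDGM Y) (toAbsLayer E Y 2
        (groupCohomology.map (MonoidHom.id _)
          ((invariantsQuotFunctor ℤ (E.openNormalSubgroup : Subgroup (absoluteGaloisGroup K))).map u) 2 w)) := by
  induction w using H2_induction_on with
  | h b =>
    -- the layer cocycle of `H²(u^{U_E}) [b]` (implicit `A`, `B` given: unifying `Rep.res (MonoidHom.id _) ?A` is expensive)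
    have h0 := H2π_comp_map_apply
      (A := (invariantsQuotFunctor ℤ (E.openNormalSubgroup : Subgroup (absoluteGaloisGroup K))).obj X)
      (B := (invariantsQuotFunctor ℤ (E.openNormalSubgroup : Subgroup (absoluteGaloisGroup K))).obj Y)
      (MonoidHom.id _) ((invariantsQuotFunctor ℤ (E.openNormalSubgroup : Subgroup (absoluteGaloisGroup K))).map u) b
    -- left side: the class of `(σ, τ) ↦ u (b([σ], [τ]))` (term-mode `congrArg`, no `rw` under the bundled applications)
    have hL : galoisCohomology.map (lmap X Y u) 2 (infTwo K E.1 (toDGM X) (toAbsLayer E X 2 (H2π _ b))) =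
        twoCocycleClass (toDGM Y).toTopRep
          (contTwoCocycles.pullback (ContinuousMonoidHom.id (absoluteGaloisGroup K))
            (X := (toDGM X).toTopRep) (Y := (toDGM Y).toTopRep)
            (TopRep.ofHom ⟨(lmap X Y u).toContinuousLinearMap, (lmap X Y u).isIntertwining'⟩)
            (inflateTwoCocycle K E.1 (toDGM X)
              (mapCocycles₂ (quotEquivAbs E).toMonoidHom (toAbsLayerHom E X) b))) :=
      (congrArg (fun z => galoisCohomology.map (lmap X Y u) 2 (infTwo K E.1 (toDGM X) z)) (toAbsLayer_H2π E X b)).trans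
        ((congrArg (galoisCohomology.map (lmap X Y u) 2) (infTwo_H2π K E.1 (toDGM X) _)).trans
          (map_twoCocycleClass _ _ _ _))
    -- right side: the class of `(σ, τ) ↦ (u^{U_E} b)([σ], [τ])`
    have hR : infTwo K E.1 (toDGM Y) (toAbsLayer E Y 2 (groupCohomology.map (MonoidHom.id _)
          ((invariantsQuotFunctor ℤ (E.openNormalSubgroup : Subgroup (absoluteGaloisGroup K))).map u) 2 (H2π _ b))) =
        twoCocycleClass (toDGM Y).toTopRep
          (inflateTwoCocycle K E.1 (toDGM Y)
            (mapCocycles₂ (quotEquivAbs E).toMonoidHom (toAbsLayerHom E Y)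
              (mapCocycles₂ (MonoidHom.id _)
                ((invariantsQuotFunctor ℤ (E.openNormalSubgroup : Subgroup (absoluteGaloisGroup K))).map u) b))) :=
      (congrArg (fun z => infTwo K E.1 (toDGM Y) (toAbsLayer E Y 2 z)) h0).trans
        ((congrArg (fun z => infTwo K E.1 (toDGM Y) z) (toAbsLayer_H2π E Y _)).trans (infTwo_H2π K E.1 (toDGM Y) _))
    refine hL.trans ((congrArg (twoCocycleClass _) (Subtype.ext (ContinuousMap.ext fun st => ?_))).trans hR.symm)
    obtain ⟨σ, τ⟩ := st
    rfl

/-! ## §2 Push-forward of a class read on a cocycle with prescribed values -/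

omit [NumberField K] in
/-- **`H²(φ)[Z] = [Z']` when `Z'(σ, τ) = φ (Z(σ, τ))` for all `σ, τ`** (`map_twoCocycleClass` + extensionality).
[cite: SerreGaloisCohomology1997, I §2.4] -/
theorem map_two_twoCocycleClass_eq_of_apply [CompactSpace (absoluteGaloisGroup K)]
    {M N : Type} [AddCommGroup M] [TopologicalSpace M] [DiscreteTopology M]
    [AddCommGroup N] [TopologicalSpace N] [DiscreteTopology N]
    {ρ : DiscreteGaloisModule K M} {ρ' : DiscreteGaloisModule K N}
    (φ : ρ.toContRepresentation →ⁱL ρ'.toContRepresentation)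
    (Z : contTwoCocycles ρ.toTopRep) (Z' : contTwoCocycles ρ'.toTopRep)
    (h : ∀ σ τ : absoluteGaloisGroup K, Z'.1 (σ, τ) = φ (Z.1 (σ, τ))) :
    galoisCohomology.map φ 2 (twoCocycleClass ρ.toTopRep Z) = twoCocycleClass ρ'.toTopRep Z' :=
  (map_twoCocycleClass _ _ _ Z).trans (congrArg (twoCocycleClass _) (Subtype.ext (ContinuousMap.ext fun st => by
    obtain ⟨σ, τ⟩ := st
    rw [contTwoCocycles.pullback_apply, h]
    rfl)))

/-! ## §3 (I1) The idèle side: `(j_C)_*` of an inflated layer class, and the layer square `iso_C ∘ (j_C^{U_E})_* = ε_E ∘ iso_J` -/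

/-- **(I1, inflation) `(j_C)_* inf_E (toAbsLayer_E w) = inf_E (toAbsLayer_E ((j_C^{U_E})_* w))`** for every
`w ∈ H²(Γ_K ⧸ U_E, J̄^{U_E})` (`j_C : J̄ → C̄` = `HomDual.ideleToClassI K` = `lmap` of door-c5's `lim (J_E → C_E)`; §1 for
`u = (ideleToClass K).limitHom`). [cite: CasselsFrohlichANT1967, Ch. VII §8, §11.1][cite: SerreGaloisCohomology1997, I §2.2 Proposition 8] -/
theorem map_ideleToClassI_infTwo_toAbsLayer (E : GalLayer K) [Normal K E.1] [FiniteDimensional K E.1]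
    (w : groupCohomology ((invariantsQuotFunctor ℤ (E.openNormalSubgroup : Subgroup (absoluteGaloisGroup K))).obj
      (ideleBarD K)) 2) :
    galoisCohomology.map (ideleToClassI K) 2 (infTwo K E.1 (toDGM (ideleBarD K)) (toAbsLayer E (ideleBarD K) 2 w)) =
      infTwo K E.1 (toDGM (classBarD K)) (toAbsLayer E (classBarD K) 2
        (groupCohomology.map (MonoidHom.id _)
          ((invariantsQuotFunctor ℤ (E.openNormalSubgroup : Subgroup (absoluteGaloisGroup K))).map
            (ideleToClass K).limitHom) 2 w)) :=
  map_lmap_infTwo_toAbsLayer E (ideleBarD K) (classBarD K) (ideleClassSeq K).g w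

/-- **(I1, layer square) `iso_C ((j_C^{U_E})_* w) = ε_E (iso_J w)`**: under door-c5's layer cohomology isomorphisms
`iso_J : H²(Γ_K ⧸ U_E, J̄^{U_E}) ≅ H²(Gal(E/K), J_E)`, `iso_C : H²(Γ_K ⧸ U_E, C̄^{U_E}) ≅ H²(Gal(E/K), C_E)` (the latter IS door-c4's
`IdeleClassBar.layerCohomologyIso`, `classData_layerCohomologyIso`), the map induced by `j_C` on door-c4's layers is the cell's
`ε_E = IdeleCohomology.ideleToClass K E = H²(Gal(E/K), J_E → C_E)` (door-c5 `functor_map_ideleToClass_comp_layerCohomologyIso`).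
[cite: CasselsFrohlichANT1967, Ch. VII §11.1, §11.2] -/
theorem layerCohomologyIso_hom_map_ideleToClass (E : GalLayer K)
    (w : groupCohomology ((invariantsQuotFunctor ℤ (E.openNormalSubgroup : Subgroup (absoluteGaloisGroup K))).obj
      (ideleBarD K)) 2) :
    (IdeleClassBar.layerCohomologyIso E 2).hom
        (groupCohomology.map (MonoidHom.id _)
          ((invariantsQuotFunctor ℤ (E.openNormalSubgroup : Subgroup (absoluteGaloisGroup K))).map
            (ideleToClass K).limitHom) 2 w) =
      (haveI := E.numberField; haveI := E.isGalois;
        IdeleCohomology.ideleToClass K E.1 (((ideleData K).layerCohomologyIso E 2).hom w)) := by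
  haveI := E.numberField
  haveI := E.isGalois
  have hsq := functor_map_ideleToClass_comp_layerCohomologyIso (F := K) E 2
  exact congrArg (fun T => (ConcreteCategory.hom T) w) hsq

/-- **(I1) packaged for the assembler.**  If `x ∈ H²_cont(Γ_K, J̄)` is the inflation `inf_E (toAbsLayer_E w)` of a class
`w ∈ H²(Γ_K ⧸ U_E, J̄^{U_E})` of door-c4's layer (w2 g11's α/β/γ triangle supplies such `E`, `w` for every `x`), then
`(j_C)_* x = inf_E (toAbsLayer_E w₂)` with `w₂ := (j_C^{U_E})_* w ∈ H²(Γ_K ⧸ U_E, C̄^{U_E})` and `iso_C w₂ = ε_E (iso_J w)`; hence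
(cell `IdeleCohomology.classInvAll_ideleToClass`) `classInvAll K E (iso_C w₂) = inv_E (iso_J w)`.
[cite: CasselsFrohlichANT1967, Ch. VII §11.1, §11.2 (bis)][cite: SerreGaloisCohomology1997, I §2.2 Proposition 8] -/
theorem ideleSide_identification (E : GalLayer K) [Normal K E.1] [FiniteDimensional K E.1]
    (w : groupCohomology ((invariantsQuotFunctor ℤ (E.openNormalSubgroup : Subgroup (absoluteGaloisGroup K))).obj
      (ideleBarD K)) 2)
    {x : galoisCohomology (toDGM (ideleBarD K)) 2}
    (hx : infTwo K E.1 (toDGM (ideleBarD K)) (toAbsLayer E (ideleBarD K) 2 w) = x) :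
    galoisCohomology.map (ideleToClassI K) 2 x =
        infTwo K E.1 (toDGM (classBarD K)) (toAbsLayer E (classBarD K) 2
          (groupCohomology.map (MonoidHom.id _)
            ((invariantsQuotFunctor ℤ (E.openNormalSubgroup : Subgroup (absoluteGaloisGroup K))).map
              (ideleToClass K).limitHom) 2 w)) ∧
      (haveI := E.numberField; haveI := E.isGalois;
        IdeleCohomology.classInvAll K E.1 ((IdeleClassBar.layerCohomologyIso E 2).hom
          (groupCohomology.map (MonoidHom.id _)
            ((invariantsQuotFunctor ℤ (E.openNormalSubgroup : Subgroup (absoluteGaloisGroup K))).map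
              (ideleToClass K).limitHom) 2 w)) =
        IdeleCohomology.inv E.1 (((ideleData K).layerCohomologyIso E 2).hom w)) := by
  haveI := E.numberField
  haveI := E.isGalois
  subst hx
  refine ⟨map_ideleToClassI_infTwo_toAbsLayer E w, ?_⟩
  rw [layerCohomologyIso_hom_map_ideleToClass E w]
  exact IdeleCohomology.classInvAll_ideleToClass K E.1 _

/-! ## §4 (I2) The presentation side: `h_* δ₁[γ]` as an inflated layer class, and road B's value for a general `h : N₁ → C̄` -/

section Presentation

variable {M : Type} [AddCommGroup M] [TopologicalSpace M] [DiscreteTopology M] (ρ : DiscreteGaloisModule K M)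

omit [NumberField K] in
/-- **Door-c5's open-layer inflation `inf_{U_E}` IS `infOneLayer_E ∘ toAbsLayerOf_E`** on `H¹(Γ_K ⧸ U_E, M^{U_E})` (both send
`[f]` to the class of the crossed homomorphism `σ ↦ f(σ̄)`: `OpenLayer.infOpen_H1π`, door-c4 g18's `ExtOneDescent.layerInfOne_H1π`).
[cite: SerreGaloisCohomology1997, I §2.2 Proposition 8][cite: NeukirchSchmidtWingberg2008, (1.5.1)] -/
theorem infOpen_eq_infOneLayer_toAbsLayerOf (E : GalLayer K) [Normal K E.1] [FiniteDimensional K E.1]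
    (c : groupCohomology ((invariantsQuotFunctor ℤ (E.openNormalSubgroup : Subgroup (absoluteGaloisGroup K))).obj
      (ofDiscreteGaloisModule ρ)) 1) :
    OpenLayer.infOpen ρ E.openNormalSubgroup c = infOneLayer K E.1 ρ (toAbsLayerOf E ρ 1 c) := by
  induction c using H1_induction_on with
  | h f =>
    have h2 : infOneLayer K E.1 ρ (toAbsLayerOf E ρ 1 (H1π _ f)) =
        oneCocycleClass ρ.toTopRep (ExtOneDescent.inflateLayerCocycle K ρ E f) :=
      ExtOneDescent.layerInfOne_H1π K ρ E f
    rw [h2, OpenLayer.infOpen_H1π]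
    exact congrArg (oneCocycleClass ρ.toTopRep) (Subtype.ext (ContinuousMap.ext fun σ => rfl))

omit [NumberField K] in
/-- **`Φ (Inf_E c) = infOneLayer_E (toAbsLayerOf_E c)`**: door-c5's comparison `Φ = OpenLayer.extOneToGaloisCohomology`
(`extOneEquiv`) on a class inflated from door-c4's layer `U_E` is the native layer inflation in door-c6's currency.
[cite: SerreGaloisCohomology1997, I §2.2 Proposition 8][cite: NeukirchSchmidtWingberg2008, (1.5.1)] -/
theorem extOneToGaloisCohomology_inflG_layer (E : GalLayer K) [Normal K E.1] [FiniteDimensional K E.1]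
    (c : groupCohomology ((invariantsQuotFunctor ℤ (E.openNormalSubgroup : Subgroup (absoluteGaloisGroup K))).obj
      (ofDiscreteGaloisModule ρ)) 1) :
    OpenLayer.extOneToGaloisCohomology ρ (LayerColimit.inflG E.openNormalSubgroup (ofDiscreteGaloisModule ρ) 1 c) =
      infOneLayer K E.1 ρ (toAbsLayerOf E ρ 1 c) := by
  rw [OpenLayer.extOneToGaloisCohomology_inflG]
  exact infOpen_eq_infOneLayer_toAbsLayerOf ρ E c

variable [Finite M]

/-- **(I2) `H²(u) (δ₁ y) = inf_E (toAbsLayer_E ((u^{U_E})_* δ_{S^{U_E}} c))`** for the canonical presentation `S : 0 → N₁ → P → M → 0`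
of `ρ`, a layer `E ⊇ K(M)`, a layer class `c ∈ H¹(Γ_K ⧸ U_E, M^{U_E})` with `Φ (Inf_E c) = y ∈ H¹(K, M)`, and any `u : N₁ ⟶ Y` in
`C_Γ` ((N2) in door-c4's currency, `LayerDelta.δ₁_infOneLayer_toAbsLayerOf`, then §1).
[cite: NeukirchSchmidtWingberg2008, (1.5.1)][cite: SerreGaloisCohomology1997, I §2.2 Proposition 8] -/
theorem map_lmap_δ₁_eq_infTwo_toAbsLayer {E : GalLayer K} [Normal K E.1] [FiniteDimensional K E.1]
    (hE : presentationLayer ρ ≤ E)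
    (c : groupCohomology ((invariantsQuotFunctor ℤ (E.openNormalSubgroup : Subgroup (absoluteGaloisGroup K))).obj
      (presentationComplex ρ).X₃) 1)
    {y : galoisCohomology ρ 1}
    (hy : OpenLayer.extOneToGaloisCohomology ρ
      (LayerColimit.inflG E.openNormalSubgroup (presentationComplex ρ).X₃ 1 c) = y)
    (Y : DiscreteRepCat ℤ (absoluteGaloisGroup K)) (u : (presentationComplex ρ).X₁ ⟶ Y) :
    galoisCohomology.map (lmap (presentationComplex ρ).X₁ Y u) 2 ((pres_isSES ρ).δ₁ y) =
      infTwo K E.1 (toDGM Y) (toAbsLayer E Y 2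
        (groupCohomology.map (MonoidHom.id _)
          ((invariantsQuotFunctor ℤ (E.openNormalSubgroup : Subgroup (absoluteGaloisGroup K))).map u) 2
          (groupCohomology.δ (presentationComplex_map_invariantsQuotFunctor_shortExact ρ hE) 1 2 rfl c))) := by
  subst hy
  have h1 : OpenLayer.extOneToGaloisCohomology ρ
      (LayerColimit.inflG E.openNormalSubgroup (presentationComplex ρ).X₃ 1 c) = infOneLayer K E.1 ρ (toAbsLayerOf E ρ 1 c) :=
    extOneToGaloisCohomology_inflG_layer ρ E c
  exact (congrArg (galoisCohomology.map (lmap (presentationComplex ρ).X₁ Y u) 2)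
      ((congrArg (fun y => (pres_isSES ρ).δ₁ y) h1).trans (δ₁_infOneLayer_toAbsLayerOf ρ hE c))).trans
    (map_lmap_infTwo_toAbsLayer E (presentationComplex ρ).X₁ Y u _)

/-- **(I2) on the bridge's idèle cocycle.**  For `E ⊇ K(M)`, `c_E ∈ H¹(Γ_K ⧸ U_E, M^{U_E})` with `Φ (Inf_E c_E) = [γ]`, `h : N₁ ⟶ C̄`,
a continuous `2`-cocycle `c` of `N₁` with `[c] = δ₁[γ]`, and a continuous idèle `2`-cocycle `Z` with `j_C (Z(σ, τ)) = h (c(σ, τ))`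
for all `σ, τ` (conjuncts (4), (5) of `exists_bridge_sum_localInvariants_eq_zero` / of `hS3`):
`(j_C)_* [Z] = inf_E (toAbsLayer_E ((h^{U_E})_* δ_{S^{U_E}} c_E))` in `H²_cont(Γ_K, C̄)`.
[cite: MilneADT2006, I §4, Thm. 4.10 (a) (proof, p. 58)][cite: NeukirchSchmidtWingberg2008, (1.5.1)] -/
theorem map_ideleToClassI_twoCocycleClass_eq_infTwo_toAbsLayer {E : GalLayer K} [Normal K E.1] [FiniteDimensional K E.1]
    (hE : presentationLayer ρ ≤ E)
    (cE : groupCohomology ((invariantsQuotFunctor ℤ (E.openNormalSubgroup : Subgroup (absoluteGaloisGroup K))).obj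
      (presentationComplex ρ).X₃) 1)
    {γ : contOneCocycles ρ.toTopRep}
    (hγ : OpenLayer.extOneToGaloisCohomology ρ
      (LayerColimit.inflG E.openNormalSubgroup (presentationComplex ρ).X₃ 1 cE) = oneCocycleClass ρ.toTopRep γ)
    (h : (presentationComplex ρ).X₁ ⟶ classBarD K)
    (c : contTwoCocycles (presModule₁ ρ).toTopRep)
    (hc : (pres_isSES ρ).δ₁ (oneCocycleClass ρ.toTopRep γ) = twoCocycleClass (presModule₁ ρ).toTopRep c)
    (Z : contTwoCocycles (toDGM (ideleBarD K)).toTopRep)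
    (hZ : ∀ σ τ : absoluteGaloisGroup K,
      ideleToClassI K (Z.1 (σ, τ)) = lmap (presentationComplex ρ).X₁ (classBarD K) h (c.1 (σ, τ))) :
    galoisCohomology.map (ideleToClassI K) 2 (twoCocycleClass (toDGM (ideleBarD K)).toTopRep Z) =
      infTwo K E.1 (toDGM (classBarD K)) (toAbsLayer E (classBarD K) 2
        (groupCohomology.map (MonoidHom.id _)
          ((invariantsQuotFunctor ℤ (E.openNormalSubgroup : Subgroup (absoluteGaloisGroup K))).map h) 2
          (groupCohomology.δ (presentationComplex_map_invariantsQuotFunctor_shortExact ρ hE) 1 2 rfl cE))) := by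
  -- `[j_C ∘ Z] = h_* [c]`: both are the class of the continuous cocycle `(σ, τ) ↦ j_C (Z(σ, τ)) = h (c(σ, τ))`
  have h1 : galoisCohomology.map (ideleToClassI K) 2 (twoCocycleClass (toDGM (ideleBarD K)).toTopRep Z) =
      galoisCohomology.map (lmap (presentationComplex ρ).X₁ (classBarD K) h) 2
        (twoCocycleClass (presModule₁ ρ).toTopRep c) :=
    (map_two_twoCocycleClass_eq_of_apply (ideleToClassI K) Z
      (contTwoCocycles.pullback (ContinuousMonoidHom.id (absoluteGaloisGroup K))
        (X := (presModule₁ ρ).toTopRep) (Y := (toDGM (classBarD K)).toTopRep)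
        (TopRep.ofHom ⟨(lmap (presentationComplex ρ).X₁ (classBarD K) h).toContinuousLinearMap,
          (lmap (presentationComplex ρ).X₁ (classBarD K) h).isIntertwining'⟩) c)
      fun σ τ => (hZ σ τ).symm).trans (map_twoCocycleClass _ _ _ c).symm
  rw [h1, ← hc]
  exact map_lmap_δ₁_eq_infTwo_toAbsLayer ρ hE cE hγ (classBarD K) h

variable [CompactSpace (absoluteGaloisGroup K)] [TotallyDisconnectedSpace (absoluteGaloisGroup K)]

/-- **Road B's value for a general `h : N₁ → C̄`** (door-c4 g17's `classBarInv_inflG_comp_boundary_eq_classInvAll` for the canonical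
presentation; the tree's `classBarInv_inflG_comp_boundary_presentation` is the case `h = f ≫ (J̄ → C̄)`): for `E ⊇ K(M)` and
`c_E ∈ H¹(Γ_K ⧸ U_E, M^{U_E})`, `classBarInv K (Inf_E c_E ∘ ∂h) = classInvAll K E (iso_E ((h^{U_E})_* δ_{S^{U_E}} c_E))`.
[cite: MilneADT2006, I §4, Thm. 4.10 (a) (proof, p. 58)][cite: CasselsFrohlichANT1967, Ch. VII §11.2 (bis)] -/
theorem classBarInv_inflG_comp_boundary_presentation_hom {E : GalLayer K} (hE : presentationLayer ρ ≤ E)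
    (cE : groupCohomology ((invariantsQuotFunctor ℤ (E.openNormalSubgroup : Subgroup (absoluteGaloisGroup K))).obj
      (presentationComplex ρ).X₃) 1)
    (h : (presentationComplex ρ).X₁ ⟶ classBarD K) :
    classBarInv K ((LayerColimit.inflG E.openNormalSubgroup (presentationComplex ρ).X₃ 1 cE).comp
        (boundary (presentationComplex_shortExact ρ) (classBarD K) h) (rfl : 1 + 1 = 2)) =
      (haveI := E.numberField; haveI := E.isGalois;
        IdeleCohomology.classInvAll K E.1 ((IdeleClassBar.layerCohomologyIso E 2).hom
          (groupCohomology.map (MonoidHom.id _)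
            ((invariantsQuotFunctor ℤ (E.openNormalSubgroup : Subgroup (absoluteGaloisGroup K))).map h) 2
            (groupCohomology.δ (presentationComplex_map_invariantsQuotFunctor_shortExact ρ hE) 1 2 rfl cE)))) :=
  -- (road B's statement applies the two `ModuleCat` morphisms through `.hom`; the displayed form here is the coercion, definitionally equal)
  classBarInv_inflG_comp_boundary_eq_classInvAll E (presentationComplex_shortExact ρ)
    (presentationComplex_map_invariantsQuotFunctor_shortExact ρ hE) cE h

/-- **(I2) packaged for the assembler (the presentation side of `hS3`).**  For every finite discrete module `ρ`, every
`h : N₁ ⟶ C̄` out of the kernel of its canonical presentation, every continuous `1`-cocycle `γ` of `ρ` and `2`-cocycle `c` of `N₁`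
with `[c] = δ₁[γ]`, there are a layer `E ⊇ K(M)` and a class `w₁ ∈ H²(Γ_K ⧸ U_E, C̄^{U_E})` of door-c4's layer with
(a) `classBarInv K (Φ⁻¹[γ] ∘ ∂h) = classInvAll K E (iso_E w₁)` (road B) and (b) `(j_C)_* [Z] = inf_E (toAbsLayer_E w₁)` for EVERY
continuous idèle `2`-cocycle `Z` with `j_C (Z(σ, τ)) = h (c(σ, τ))` (door-c5's `exists_layer_ge_inflG_eq` for `Φ⁻¹[γ]`, then
`classBarInv_inflG_comp_boundary_presentation_hom` and `map_ideleToClassI_twoCocycleClass_eq_infTwo_toAbsLayer`).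
[cite: MilneADT2006, I §4, Thm. 4.10 (a) (proof, p. 58)][cite: CasselsFrohlichANT1967, Ch. VII §11.2 (bis)]
[cite: SerreGaloisCohomology1997, I §2.2 Proposition 8 and Corollary 1] -/
theorem presentationSide_identification (h : (presentationComplex ρ).X₁ ⟶ classBarD K)
    (γ : contOneCocycles ρ.toTopRep) (c : contTwoCocycles (presModule₁ ρ).toTopRep)
    (hc : (pres_isSES ρ).δ₁ (oneCocycleClass ρ.toTopRep γ) = twoCocycleClass (presModule₁ ρ).toTopRep c) :
    ∃ (E : GalLayer K) (_ : presentationLayer ρ ≤ E) (_ : Normal K E.1) (_ : FiniteDimensional K E.1)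
      (w₁ : groupCohomology ((invariantsQuotFunctor ℤ (E.openNormalSubgroup : Subgroup (absoluteGaloisGroup K))).obj
        (classBarD K)) 2),
      classBarInv K (((OpenLayer.extOneEquiv ρ).symm (oneCocycleClass ρ.toTopRep γ)).comp
          (boundary (presentationComplex_shortExact ρ) (classBarD K) h) (rfl : 1 + 1 = 2)) =
        (haveI := E.numberField; haveI := E.isGalois;
          IdeleCohomology.classInvAll K E.1 ((IdeleClassBar.layerCohomologyIso E 2).hom w₁)) ∧
      ∀ (Z : contTwoCocycles (toDGM (ideleBarD K)).toTopRep),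
        (∀ σ τ : absoluteGaloisGroup K,
          ideleToClassI K (Z.1 (σ, τ)) = lmap (presentationComplex ρ).X₁ (classBarD K) h (c.1 (σ, τ))) →
        galoisCohomology.map (ideleToClassI K) 2 (twoCocycleClass (toDGM (ideleBarD K)).toTopRep Z) =
          infTwo K E.1 (toDGM (classBarD K)) (toAbsLayer E (classBarD K) 2 w₁) := by
  obtain ⟨E, hE, cE, hcE⟩ := exists_layer_ge_inflG_eq (presentationLayer ρ) (presentationComplex ρ).X₃ 1
    ((OpenLayer.extOneEquiv ρ).symm (oneCocycleClass ρ.toTopRep γ))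
  haveI : Normal K E.1 := normal_layer E
  haveI : FiniteDimensional K E.1 := finiteDimensional_layer E
  -- `Φ (Inf_E c_E) = [γ]` and road B's value, both by term-mode transport along `hcE` (no `rw` under `Ext`/`classBarInv`)
  have hγ : OpenLayer.extOneToGaloisCohomology ρ
      (LayerColimit.inflG E.openNormalSubgroup (presentationComplex ρ).X₃ 1 cE) = oneCocycleClass ρ.toTopRep γ :=
    (congrArg (OpenLayer.extOneToGaloisCohomology ρ) hcE).trans (OpenLayer.extOneToGaloisCohomology_symm_apply ρ _)
  have ha := (congrArg (fun e : Ext (triv (k := ℤ) (Γ := absoluteGaloisGroup K) ℤ) (presentationComplex ρ).X₃ 1 =>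
      classBarInv K (e.comp (boundary (presentationComplex_shortExact ρ) (classBarD K) h) (rfl : 1 + 1 = 2))) hcE).symm.trans
    (classBarInv_inflG_comp_boundary_presentation_hom ρ hE cE h)
  exact ⟨E, hE, inferInstance, inferInstance, _, ha,
    fun Z hZ => map_ideleToClassI_twoCocycleClass_eq_infTwo_toAbsLayer ρ hE cE hγ h c hc Z hZ⟩

end Presentation

end Summit.BirchSwinnertonDyer.BirchSwinnertonDyer.Theorems.ShaTwoCochain

end
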